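import Literature.Computability.Cryptography.PeikertPerturbationGaussian
import Literature.Algebra.EuclideanLattices.GaussianCosetSmoothing
import Literature.Algebra.EuclideanLattices.GaussianLatticeSums
import Mathlib.MeasureTheory.Group.FundamentalDomain
import Mathlib.Algebra.Module.ZLattice.Covolume
import HarnessLib

/-!
# Regev 2009, Lemma 3.2 (bootstrapping): rounding a wide continuous Gaussian to the lattice gives `D_{L,r}`

Topic `Computability/Cryptography` (family `pqc`), grouping namespace `Regev2009`. The mathematical
content of the BOOTSTRAP of Regev's quantum reduction (J. ACM 56 (2009), art. 34; author's version
arXiv:2401.03703, Lemma 3.2, p. 15) — the first stage (`BOOT`) of the stage family of Theorem 3.1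
(`RegevStageKernelLaws.lean`, `RegevMainTheoremStages.lean`; named facts
`Literature.Computability.Cryptography.regev_lwe_to_sivp_quantum` / `…regev_lwe_to_gapSVP_quantum`,
pqc.S19):

> *Lemma 3.2 (Bootstrapping). There exists an efficient algorithm that, given any `n`-dimensional
> lattice `L` and `r > 2^{2n} λₙ(L)`, outputs a sample from a distribution that is within statistical
> distance `2^{-Ω(n)}` of `D_{L,r}`. Proof. By using the LLL basis reduction algorithm, we obtain a
> basis for `L` of length at most `2ⁿ λₙ(L)` and let `P(L)` be the parallelepiped generated by this
> basis. The sampling procedure samples a vector `y` from `ν_r` and then outputs `y - (y mod P(L)) ∈ L`.*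

We formalise the distributional statement behind it, in the generality a finite-precision machine
needs (Regev, §2 p. 11, footnote: "when only finite precision is available, `ν_s` can be approximated
by picking a fine grid … all our arguments can be made rigorous by selecting a sufficiently fine
grid" — rounding a grid point to the lattice is rounding the continuous Gaussian through the
fundamental domain `(P(B) ∩ grid) + cell`, which is no longer a parallelepiped but is still a bounded
measurable fundamental domain):

* `Regev2009.roundedGaussian L D s : PMF L` — for a full lattice `L ⊆ E` and a measurable fundamental
  domain `D` of `L` (Mathlib's `MeasureTheory.IsAddFundamentalDomain L D volume`), the law of
  "`y - (y mod D)`" for `y ∼ ν_s` (the tree's `continuousGaussian E s`): the lattice point `x` receives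
  the Gaussian measure of the tile `x + D` (`roundedGaussian_apply`);
* `Regev2009.gaussianFunction_ge_of_norm_le` — **Claim 2.1**: `‖x‖ ≤ t`, `‖y - x‖ ≤ l` ⟹
  `ρ_s(y) ≥ (1 - π(2lt + l²)/s²) ρ_s(x)`;
* `Regev2009.toReal_discreteGaussian_le` — the Poisson step of the proof:
  `D_{L,s}(x) ≤ vol(ℝⁿ/L) · ρ_s(x)/sⁿ` (`ρ_s(L) = sⁿ ρ_{1/s}(L*)/vol(ℝⁿ/L) ≥ sⁿ/vol(ℝⁿ/L)`, the tree's
  `tsum_gaussianFunction_eq`, Regev's Lemma 2.14);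
* `PMF.tvDist_le_of_forall_mem_le` — generic: if `p ≥ (1 - c)·q` pointwise on a set `S` then
  `Δ(p, q) ≤ c + q(Sᶜ)` (Goldreich 2001, §3.2.1);
* **`Regev2009.tvDist_roundedGaussian_discreteGaussian_le`** — **Lemma 3.2, distributional form**: if
  `D ⊆ B̄(0, d)` then `Δ(roundedGaussian L D s, D_{L,s}) ≤ π(2√n·(d/s) + (d/s)²) + 2⁻ⁿ` — Regev's proof
  verbatim: on the ball `‖x‖ < s√n` the tile `x + D` has Gaussian measure
  `≥ (1 - π(2√n d/s + d²/s²))·vol(D)·ρ_s(x)/sⁿ ≥ (1 - …)·D_{L,s}(x)` (Claim 2.1 and the Poisson step), and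
  `D_{L,s}` puts mass `≤ 2⁻ⁿ` outside that ball (Banaszczyk 1993, Lemma 1.5(i) = Regev's Lemma 2.5, the
  tree's `Peikert2009.toOuterMeasure_discreteGaussian_norm_ge_le`);
* `Regev2009.tvDist_roundedGaussian_fundamentalDomain_le` — the parallelepiped case `D = P(b)` of a
  basis `b` (`ZSpan.fundamentalDomain`, `d = ∑ᵢ ‖bᵢ‖`, `ZSpan.norm_fract_le`), and
  `Regev2009.tvDist_roundedGaussian_le_of_forall_norm_le` — Regev's numbers: a basis of vectors of
  norm `≤ M` and a width `s ≥ n·2ⁿ·M` give `Δ ≤ (2π√n + π + 1)·2⁻ⁿ` (with an LLL-reduced basis,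
  `‖bᵢ‖ ≤ 2^{(n-1)/2} λₙ(L)` by the tree's `norm_sq_le_two_pow_mul_successiveMinimum_sq_holds`, this
  is the printed hypothesis `r > 2^{2n} λₙ(L)` with room to spare);
* `Regev2009.tvDist_discreteGaussian_le_one_sub_pow` / `…_le_mul_one_sub_div` — the width slack a
  finite-precision sampler needs: `Δ(D_{L,s'}, D_{L,s}) ≤ 1 - (s/s')ⁿ ≤ n(1 - s/s')` for `0 < s ≤ s'`
  (`ρ_{s'}(L) ≤ (s'/s)ⁿ ρ_s(L)`, Banaszczyk's Lemma 1.4(i) = Regev's Lemma 2.4, the tree's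
  `tsum_gaussianFunction_sub_le_pow_mul`).

Everything here is proved; no named fact is introduced. The machine (LLL, a coin-driven grid
Gaussian, the floor in basis coordinates) is the sequel.

## References

* O. Regev, *On lattices, learning with errors, random linear codes, and cryptography*, J. ACM 56
  (2009), art. 34; author's version arXiv:2401.03703: Lemma 3.2 and its proof (p. 15), Claim 2.1
  (p. 11), Lemma 2.5 (p. 13), Lemma 2.14 (p. 14), §2 footnote on finite precision (p. 11) [Regev2009].
* W. Banaszczyk, *New bounds in some transference theorems in the geometry of numbers*, Math. Ann.
  296 (1993), Lemma 1.1(i), Lemma 1.5(i) [Banaszczyk1993].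
* O. Goldreich, *Foundations of Cryptography* I, CUP 2001, §3.2.1 (statistical distance)
  [Goldreich2001].
-/

noncomputable section

open MeasureTheory Metric Module Literature.Algebra.EuclideanLattices
open scoped ENNReal Real Pointwise

/-! ### Generic: one-sided domination on a set bounds the statistical distance -/

namespace PMF

/-- **One-sided domination on a set bounds the statistical distance.** For probability mass functions
`p, q`, a set `S` and `0 ≤ c`: if `(1 - c)·q(a) ≤ p(a)` for all `a ∈ S`, then
`Δ(p, q) = ∑ (q - p)⁺ ≤ c + q(Sᶜ)`. [cite: Goldreich2001, §3.2.1] -/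
theorem tvDist_le_of_forall_mem_le {α : Type*} (p q : PMF α) (S : Set α) {c : ℝ} (hc : 0 ≤ c)
    (h : ∀ a ∈ S, (1 - c) * (q a).toReal ≤ (p a).toReal) :
    p.tvDist q ≤ c + (q.toOuterMeasure Sᶜ).toReal := by
  classical
  set m : α → ℝ := fun a => (p a).toReal with hm
  set n : α → ℝ := fun a => (q a).toReal with hn
  have hm0 : ∀ a, 0 ≤ m a := fun a => ENNReal.toReal_nonneg
  have hn0 : ∀ a, 0 ≤ n a := fun a => ENNReal.toReal_nonneg
  have hm1 : ∑' a, m a = 1 := PMF.tsum_coe_toReal p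
  have hn1 : ∑' a, n a = 1 := PMF.tsum_coe_toReal q
  have hms : Summable m := PMF.summable_coe_toReal p
  have hns : Summable n := PMF.summable_coe_toReal q
  -- `|m - n| = (m - n) + 2 (n - m)⁺`
  have habs : ∀ a, |m a - n a| = (m a - n a) + 2 * max (n a - m a) 0 := by
    intro a
    rcases le_or_gt (n a) (m a) with hle | hlt
    · rw [max_eq_right (by linarith), abs_of_nonneg (by linarith)]; ring
    · rw [max_eq_left (by linarith), abs_of_neg (by linarith)]; ring
  have hmaxs : Summable fun a => max (n a - m a) 0 :=
    Summable.of_nonneg_of_le (fun a => le_max_right _ _)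
      (fun a => max_le (sub_le_self _ (hm0 a)) (hn0 a)) hns
  -- the dominating function
  set g : α → ℝ := fun a => S.indicator (fun a => c * n a) a + Sᶜ.indicator n a with hg
  have hdom : ∀ a, max (n a - m a) 0 ≤ g a := by
    intro a
    by_cases ha : a ∈ S
    · have h' := h a ha
      simp only [hg, Set.indicator_of_mem ha, Set.indicator_of_notMem (Set.notMem_compl_iff.2 ha),
        add_zero]
      exact max_le (by nlinarith [hn0 a]) (mul_nonneg hc (hn0 a))
    · simp only [hg, Set.indicator_of_notMem ha, Set.indicator_of_mem (Set.mem_compl ha), zero_add]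
      exact max_le (sub_le_self _ (hm0 a)) (hn0 a)
  have hg1s : Summable (S.indicator fun a => c * n a) := (hns.mul_left c).indicator S
  have hg2s : Summable (Sᶜ.indicator n) := hns.indicator Sᶜ
  have hgs : Summable g := hg1s.add hg2s
  -- the two parts of `∑ g`
  have h1 : ∑' a, S.indicator (fun a => c * n a) a ≤ c := by
    calc ∑' a, S.indicator (fun a => c * n a) a ≤ ∑' a, c * n a :=
          hg1s.tsum_le_tsum (fun a => Set.indicator_le_self' (fun _ _ => mul_nonneg hc (hn0 _)) a)
            (hns.mul_left c)
      _ = c := by rw [tsum_mul_left, hn1, mul_one]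
  have h2 : ∑' a, Sᶜ.indicator n a = (q.toOuterMeasure Sᶜ).toReal := by
    rw [PMF.toOuterMeasure_apply, ENNReal.tsum_toReal_eq (fun a => by
      refine ne_top_of_le_ne_top (PMF.apply_ne_top q a) ?_
      exact Set.indicator_le_self _ _ a)]
    refine tsum_congr fun a => ?_
    by_cases ha : a ∈ Sᶜ
    · rw [Set.indicator_of_mem ha, Set.indicator_of_mem ha]
    · rw [Set.indicator_of_notMem ha, Set.indicator_of_notMem ha, ENNReal.toReal_zero]
  -- the statistical distance is `∑ (n - m)⁺`
  have htv : p.tvDist q = ∑' a, max (n a - m a) 0 := by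
    unfold PMF.tvDist
    have hsub : Summable fun a => m a - n a := hms.sub hns
    calc 2⁻¹ * ∑' a, |(p a).toReal - (q a).toReal| = 2⁻¹ * ∑' a, ((m a - n a) + 2 * max (n a - m a) 0) := by
          congr 1
          exact tsum_congr fun a => habs a
      _ = 2⁻¹ * ((∑' a, m a - ∑' a, n a) + 2 * ∑' a, max (n a - m a) 0) := by
          rw [hsub.tsum_add (hmaxs.mul_left 2), hms.tsum_sub hns, tsum_mul_left]
      _ = ∑' a, max (n a - m a) 0 := by rw [hm1, hn1]; ring
  rw [htv]
  calc ∑' a, max (n a - m a) 0 ≤ ∑' a, g a := hmaxs.tsum_le_tsum hdom hgs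
    _ = ∑' a, S.indicator (fun a => c * n a) a + ∑' a, Sᶜ.indicator n a := hg1s.tsum_add hg2s
    _ ≤ c + (q.toOuterMeasure Sᶜ).toReal := by rw [h2]; exact add_le_add h1 le_rfl

end PMF

namespace Literature.Computability.Cryptography

namespace Regev2009

/-! ### Claim 2.1: a small change of the argument does not shrink `ρ_s` by much -/

section Claim21

variable {E : Type*} [NormedAddCommGroup E]

/-- **Regev 2009, Claim 2.1** (exponential form): for `‖x‖ ≤ t` and `‖y - x‖ ≤ l` (`0 ≤ l`),
`ρ_s(y) ≥ e^{-π(2lt + l²)/s²} ρ_s(x)` — since `‖y‖² ≤ (‖x‖ + l)² ≤ ‖x‖² + 2lt + l²`.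
[cite: Regev2009, Claim 2.1 (proof)] -/
theorem exp_mul_gaussianFunction_le_of_norm_le {s t l : ℝ} {x y : E} (hl : 0 ≤ l) (hx : ‖x‖ ≤ t)
    (hy : ‖y - x‖ ≤ l) :
    Real.exp (-π * (2 * l * t + l ^ 2) / s ^ 2) * gaussianFunction s x ≤ gaussianFunction s y := by
  unfold gaussianFunction
  rw [← Real.exp_add]
  refine Real.exp_le_exp.2 ?_
  have hyn : ‖y‖ ≤ ‖x‖ + l := by
    calc ‖y‖ = ‖x + (y - x)‖ := by rw [add_sub_cancel]
      _ ≤ ‖x‖ + ‖y - x‖ := norm_add_le _ _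
      _ ≤ ‖x‖ + l := by linarith
  have hx0 : 0 ≤ ‖x‖ := norm_nonneg x
  have hsq : ‖y‖ ^ 2 ≤ ‖x‖ ^ 2 + (2 * l * t + l ^ 2) := by
    calc ‖y‖ ^ 2 ≤ (‖x‖ + l) ^ 2 := by
          exact pow_le_pow_left₀ (norm_nonneg y) hyn 2
      _ = ‖x‖ ^ 2 + (2 * l * ‖x‖ + l ^ 2) := by ring
      _ ≤ ‖x‖ ^ 2 + (2 * l * t + l ^ 2) := by nlinarith
  have hπ : -π ≤ 0 := by linarith [Real.pi_pos]
  have hmul : -π * (‖x‖ ^ 2 + (2 * l * t + l ^ 2)) ≤ -π * ‖y‖ ^ 2 :=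
    mul_le_mul_of_nonpos_left hsq hπ
  have hdiv := div_le_div_of_nonneg_right hmul (sq_nonneg s)
  calc -π * (2 * l * t + l ^ 2) / s ^ 2 + -π * ‖x‖ ^ 2 / s ^ 2
        = -π * (‖x‖ ^ 2 + (2 * l * t + l ^ 2)) / s ^ 2 := by ring
    _ ≤ -π * ‖y‖ ^ 2 / s ^ 2 := hdiv

/-- **Regev 2009, Claim 2.1**: for all `s, t, l` (`0 ≤ l`) and `x, y` with `‖x‖ ≤ t` and
`‖x - y‖ ≤ l`, `ρ_s(y) ≥ (1 - π(2lt + l²)/s²) ρ_s(x)` (from the exponential form and `e^{-z} ≥ 1 - z`).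
[cite: Regev2009, Claim 2.1] -/
theorem gaussianFunction_ge_of_norm_le {s t l : ℝ} {x y : E} (hl : 0 ≤ l) (hx : ‖x‖ ≤ t)
    (hy : ‖y - x‖ ≤ l) :
    (1 - π * (2 * l * t + l ^ 2) / s ^ 2) * gaussianFunction s x ≤ gaussianFunction s y := by
  refine le_trans ?_ (exp_mul_gaussianFunction_le_of_norm_le hl hx hy)
  refine mul_le_mul_of_nonneg_right ?_ (gaussianFunction_pos s x).le
  have h := Real.one_sub_le_exp_neg (π * (2 * l * t + l ^ 2) / s ^ 2)
  rwa [show -(π * (2 * l * t + l ^ 2) / s ^ 2) = -π * (2 * l * t + l ^ 2) / s ^ 2 by ring] at h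

end Claim21

/-! ### The Poisson step: `D_{L,s}(x) ≤ vol(ℝⁿ/L)·ρ_s(x)/sⁿ` -/

section Lattice

variable {E : Type*} [NormedAddCommGroup E] [InnerProductSpace ℝ E] [FiniteDimensional ℝ E]
  [MeasurableSpace E] [BorelSpace E]
variable (L : Submodule ℤ E) [DiscreteTopology L] [IsZLattice ℝ L]

/-- **The Poisson lower bound for the Gaussian mass of a lattice**: `ρ_s(L) ≥ sⁿ / vol(ℝⁿ/L)` for
`0 < s` (`ρ_s(L) = vol(ℝⁿ/L)⁻¹ sⁿ ρ_{1/s}(L*)` and `ρ_{1/s}(L*) ≥ ρ_{1/s}(0) = 1`).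
[cite: Regev2009, Lemma 2.14 (use in the proof of Lemma 3.2: "the denominator is … ≥ det(L*)·rⁿ")] -/
theorem pow_div_covolume_le_tsum_gaussianFunction {s : ℝ} (hs : 0 < s) :
    s ^ finrank ℝ E / ZLattice.covolume L ≤ ∑' y : L, gaussianFunction s (y : E) := by
  rw [tsum_gaussianFunction_eq L hs]
  have hsum : Summable fun w : dualLattice L => gaussianFunction s⁻¹ (w : E) :=
    (summable_gaussianFunction_sub (dualLattice L) (inv_ne_zero hs.ne') (0 : E)).congr fun w => by
      rw [sub_zero]
  have h1 : (1 : ℝ) ≤ ∑' w : dualLattice L, gaussianFunction s⁻¹ (w : E) := by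
    have h0 : gaussianFunction s⁻¹ ((0 : dualLattice L) : E) = 1 := by
      simp [gaussianFunction]
    rw [← h0]
    exact hsum.le_tsum 0 fun w _ => (gaussianFunction_pos _ _).le
  have hc : 0 < ZLattice.covolume L := ZLattice.covolume_pos L volume
  rw [div_eq_mul_inv, mul_comm]
  calc (ZLattice.covolume L)⁻¹ * s ^ finrank ℝ E = (ZLattice.covolume L)⁻¹ * s ^ finrank ℝ E * 1 := by
        rw [mul_one]
    _ ≤ (ZLattice.covolume L)⁻¹ * s ^ finrank ℝ E * ∑' w : dualLattice L, gaussianFunction s⁻¹ (w : E) :=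
        mul_le_mul_of_nonneg_left h1 (mul_nonneg (inv_nonneg.2 hc.le) (pow_nonneg hs.le _))

/-- The Gaussian sum over a lattice is positive. [folklore] -/
theorem tsum_gaussianFunction_pos {s : ℝ} (hs : 0 < s) : 0 < ∑' y : L, gaussianFunction s (y : E) :=
  lt_of_lt_of_le (div_pos (pow_pos hs _) (ZLattice.covolume_pos L volume))
    (pow_div_covolume_le_tsum_gaussianFunction L hs)

/-- The centred discrete Gaussian at a point, as a real number: `D_{L,s}(x) = ρ_s(x)/ρ_s(L)`.
[cite: Regev2009, §2 (eq. (6), definition of `D_{A,s}`)] -/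
theorem toReal_discreteGaussian_eq {s : ℝ} (hs : 0 < s) (x : L) :
    (discreteGaussian L s 0 x).toReal = gaussianFunction s (x : E) / ∑' y : L, gaussianFunction s (y : E) := by
  have hZ' : ∑' y : L, gaussianFunction s ((y : E) - 0) = ∑' y : L, gaussianFunction s (y : E) :=
    tsum_congr fun y => by rw [sub_zero]
  rw [discreteGaussian_apply L hs 0 x, gaussianMass_coe_eq_ofReal_tsum L hs.ne' 0, hZ', sub_zero,
    ENNReal.toReal_mul, ENNReal.toReal_inv, ENNReal.toReal_ofReal (gaussianFunction_pos _ _).le,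
    ENNReal.toReal_ofReal (tsum_gaussianFunction_pos L hs).le, div_eq_mul_inv]

/-- **The Poisson step of Regev's proof of Lemma 3.2**: for `0 < s` and a lattice point `x`,
`D_{L,s}(x) = ρ_s(x)/ρ_s(L) ≤ vol(ℝⁿ/L) · ρ_s(x)/sⁿ = det(L) ν_s(x)`.
[cite: Regev2009, Lemma 3.2 (proof: "hence the probability is at most … det(L) ν_r(x)")] -/
theorem toReal_discreteGaussian_le {s : ℝ} (hs : 0 < s) (x : L) :
    (discreteGaussian L s 0 x).toReal ≤
      ZLattice.covolume L * gaussianFunction s (x : E) / s ^ finrank ℝ E := by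
  set Z : ℝ := ∑' y : L, gaussianFunction s (y : E) with hZ
  have hZpos : 0 < Z := tsum_gaussianFunction_pos L hs
  rw [toReal_discreteGaussian_eq L hs x]
  have hc : 0 < ZLattice.covolume L := ZLattice.covolume_pos L volume
  have hsn : 0 < s ^ finrank ℝ E := pow_pos hs _
  have hkey : s ^ finrank ℝ E / ZLattice.covolume L ≤ Z := pow_div_covolume_le_tsum_gaussianFunction L hs
  -- after the rewrite the sum is displayed through `Z`
  show gaussianFunction s (x : E) / Z ≤ _
  rw [div_le_div_iff₀ hZpos hsn]
  have hρ : 0 ≤ gaussianFunction s (x : E) := (gaussianFunction_pos _ _).le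
  have hk' : s ^ finrank ℝ E ≤ Z * ZLattice.covolume L := (div_le_iff₀ hc).1 hkey
  linarith [mul_le_mul_of_nonneg_left hk' hρ]

/-! ### Changing the width of a discrete Gaussian -/

/-- **A wider discrete Gaussian dominates a narrower one up to the factor `(s/s')ⁿ`**: for
`0 < s ≤ s'` and every lattice point `x`, `(s/s')ⁿ · D_{L,s}(x) ≤ D_{L,s'}(x)` — since
`ρ_s(x) ≤ ρ_{s'}(x)` and `ρ_{s'}(L) ≤ (s'/s)ⁿ ρ_s(L)` (Banaszczyk 1993, Lemma 1.4(i) = Regev's Lemma 2.4,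
the tree's `tsum_gaussianFunction_sub_le_pow_mul`). [cite: Regev2009, Lemma 2.4] -/
theorem pow_mul_discreteGaussian_le_of_le {s s' : ℝ} (hs : 0 < s) (hss' : s ≤ s') (x : L) :
    (s / s') ^ finrank ℝ E * (discreteGaussian L s 0 x).toReal ≤ (discreteGaussian L s' 0 x).toReal := by
  have hs' : 0 < s' := hs.trans_le hss'
  set n : ℕ := finrank ℝ E with hn
  set Z : ℝ := ∑' y : L, gaussianFunction s (y : E) with hZ
  set Z' : ℝ := ∑' y : L, gaussianFunction s' (y : E) with hZ'
  have hZpos : 0 < Z := tsum_gaussianFunction_pos L hs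
  have hZ'pos : 0 < Z' := tsum_gaussianFunction_pos L hs'
  rw [toReal_discreteGaussian_eq L hs x, toReal_discreteGaussian_eq L hs' x]
  -- `Z' ≤ (s'/s)ⁿ Z`
  have ht : 1 ≤ s' / s := (one_le_div hs).2 hss'
  have hZZ : Z' ≤ (s' / s) ^ n * Z := by
    have h := tsum_gaussianFunction_sub_le_pow_mul L hs ht (0 : E)
    have h1 : (fun y : L => gaussianFunction (s' / s * s) ((y : E) - 0)) = fun y : L => gaussianFunction s' (y : E) := by
      funext y; rw [sub_zero, div_mul_cancel₀ _ hs.ne']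
    rw [h1] at h
    exact h
  have hρ : gaussianFunction s (x : E) ≤ gaussianFunction s' (x : E) := gaussianFunction_mono_left hs hss' _
  have hρ0 : 0 ≤ gaussianFunction s (x : E) := (gaussianFunction_pos _ _).le
  have hpow : (s / s') ^ n * (s' / s) ^ n = 1 := by
    rw [← mul_pow, div_mul_div_comm, mul_comm s s', div_self (mul_pos hs' hs).ne', one_pow]
  have hq : 0 < (s / s') ^ n := pow_pos (div_pos hs hs') _
  -- `(s/s')ⁿ ρ_s(x)/Z ≤ ρ_s(x)/Z' ≤ ρ_{s'}(x)/Z'`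
  calc (s / s') ^ n * (gaussianFunction s (x : E) / Z)
        = gaussianFunction s (x : E) / ((s' / s) ^ n * Z) := by
          rw [eq_div_iff (mul_pos (pow_pos (hs'.trans_le' (le_refl _) |> fun h => div_pos h hs) _) hZpos).ne']
          calc (s / s') ^ n * (gaussianFunction s (x : E) / Z) * ((s' / s) ^ n * Z)
                = ((s / s') ^ n * (s' / s) ^ n) * gaussianFunction s (x : E) * (Z / Z) := by ring
            _ = gaussianFunction s (x : E) := by rw [hpow, div_self hZpos.ne']; ring
    _ ≤ gaussianFunction s (x : E) / Z' := div_le_div_of_nonneg_left hρ0 hZ'pos hZZ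
    _ ≤ gaussianFunction s' (x : E) / Z' := div_le_div_of_nonneg_right hρ hZ'pos.le

/-- **Statistical distance between discrete Gaussians of nearby widths**: for `0 < s ≤ s'`,
`Δ(D_{L,s'}, D_{L,s}) ≤ 1 - (s/s')ⁿ` (one-sided domination everywhere). [cite: Regev2009, Lemma 2.4] -/
theorem tvDist_discreteGaussian_le_one_sub_pow {s s' : ℝ} (hs : 0 < s) (hss' : s ≤ s') :
    (discreteGaussian L s' 0).tvDist (discreteGaussian L s 0) ≤ 1 - (s / s') ^ finrank ℝ E := by
  have hs' : 0 < s' := hs.trans_le hss'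
  have hc : 0 ≤ 1 - (s / s') ^ finrank ℝ E :=
    sub_nonneg.2 (pow_le_one₀ (div_nonneg hs.le hs'.le) ((div_le_one hs').2 hss'))
  have h := PMF.tvDist_le_of_forall_mem_le (discreteGaussian L s' 0) (discreteGaussian L s 0) Set.univ hc
    (fun x _ => by
      rw [sub_sub_cancel]
      exact pow_mul_discreteGaussian_le_of_le L hs hss' x)
  simpa using h

/-- **Statistical distance between discrete Gaussians of nearby widths, linear form**: for
`0 < s ≤ s'`, `Δ(D_{L,s'}, D_{L,s}) ≤ n · (1 - s/s')` (Bernoulli). A sampler that hits the width only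
to relative precision `δ` is `nδ`-close in law. [cite: Regev2009, Lemma 2.4] -/
theorem tvDist_discreteGaussian_le_mul_one_sub_div {s s' : ℝ} (hs : 0 < s) (hss' : s ≤ s') :
    (discreteGaussian L s' 0).tvDist (discreteGaussian L s 0) ≤ finrank ℝ E * (1 - s / s') := by
  have hs' : 0 < s' := hs.trans_le hss'
  refine (tvDist_discreteGaussian_le_one_sub_pow L hs hss').trans ?_
  have hτ : 0 ≤ 1 - s / s' := sub_nonneg.2 ((div_le_one hs').2 hss')
  have hB := one_add_mul_le_pow (show (-2 : ℝ) ≤ -(1 - s / s') by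
    have : s / s' ≤ 1 := (div_le_one hs').2 hss'
    have : 0 ≤ s / s' := div_nonneg hs.le hs'.le
    linarith) (finrank ℝ E)
  have heq : (1 + -(1 - s / s')) = s / s' := by ring
  rw [heq] at hB
  linarith

/-! ### The rounded continuous Gaussian -/

/-- The continuous Gaussian is absolutely continuous with respect to Lebesgue measure. [folklore] -/
theorem continuousGaussian_absolutelyContinuous (s : ℝ) :
    continuousGaussian E s ≪ (volume : Measure E) :=
  withDensity_absolutelyContinuous _ _

/-- The tiles `x + D`, `x ∈ L`, of a fundamental domain carry Gaussian measures summing to `1`.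
[cite: Regev2009, Lemma 3.2 (proof: the procedure outputs `y - (y mod P(L)) ∈ L`)] -/
theorem hasSum_continuousGaussian_vadd {D : Set E} (hD : IsAddFundamentalDomain L D volume) {s : ℝ}
    (hs : 0 < s) : HasSum (fun x : L => continuousGaussian E s ((x : E) +ᵥ D)) 1 := by
  have : MeasurableVAdd L E := (inferInstance : MeasurableVAdd L.toAddSubgroup E)
  have : VAddInvariantMeasure L E volume := (inferInstance : VAddInvariantMeasure L.toAddSubgroup E volume)
  haveI := isProbabilityMeasure_continuousGaussian (E := E) hs
  have h := hD.measure_eq_tsum_of_ac (ν := continuousGaussian E s)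
    (continuousGaussian_absolutelyContinuous (E := E) s) Set.univ
  simp only [Set.univ_inter, measure_univ] at h
  rw [h]
  exact ENNReal.summable.hasSum

/-- **The rounded continuous Gaussian** `round_D(ν_s)`: the law of `y - (y mod D) ∈ L` for `y ∼ ν_s`,
where `y mod D` is the representative of `y` in the fundamental domain `D` of `L` — the lattice point
`x` gets the Gaussian measure of its tile `x + D`. For `D = P(B)` the parallelepiped of a basis this
is Regev's bootstrap sampler; a finite-precision sampler on a grid commensurable with an integer
lattice is the case `D = (P(B) ∩ grid) + cell`. Junk value (the point mass at `0`) unless `D` is a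
fundamental domain and `0 < s`. [cite: Regev2009, Lemma 3.2 (proof)] -/
def roundedGaussian (D : Set E) (s : ℝ) : PMF L :=
  open Classical in
  if h : IsAddFundamentalDomain L D volume ∧ 0 < s then
    ⟨fun x : L => continuousGaussian E s ((x : E) +ᵥ D), hasSum_continuousGaussian_vadd L h.1 h.2⟩
  else PMF.pure 0

/-- The rounded Gaussian at a lattice point: the Gaussian measure of its tile.
[cite: Regev2009, Lemma 3.2 (proof: "the probability given to x ∈ L by our procedure is ∫_{x+P(L)} ν_r")] -/
theorem roundedGaussian_apply {D : Set E} (hD : IsAddFundamentalDomain L D volume) {s : ℝ} (hs : 0 < s)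
    (x : L) : roundedGaussian L D s x = continuousGaussian E s ((x : E) +ᵥ D) := by
  classical
  unfold roundedGaussian
  rw [dif_pos ⟨hD, hs⟩]
  rfl

/-- **The tile of a point of the ball carries almost its ideal mass** (the core inequality of the
proof of Lemma 3.2): if `D ⊆ B̄(0,d)` is a measurable fundamental domain of `L`, `0 < s`, and
`‖x‖ ≤ s√n`, then `ν_s(x + D) ≥ (1 - π(2√n·d/s + (d/s)²)) · vol(D) ρ_s(x)/sⁿ ≥ (1 - …)·D_{L,s}(x)`.
[cite: Regev2009, Lemma 3.2 (proof, displayed inequality) with Claim 2.1 and Lemma 2.14] -/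
theorem one_sub_mul_discreteGaussian_le_roundedGaussian {D : Set E} (hD : IsAddFundamentalDomain L D volume)
    (hDm : MeasurableSet D) {d : ℝ} (hd0 : 0 ≤ d) (hd : ∀ u ∈ D, ‖u‖ ≤ d) {s : ℝ} (hs : 0 < s) (x : L)
    (hx : ‖(x : E)‖ ≤ s * Real.sqrt (finrank ℝ E)) :
    (1 - π * (2 * Real.sqrt (finrank ℝ E) * (d / s) + (d / s) ^ 2)) * (discreteGaussian L s 0 x).toReal ≤
      (roundedGaussian L D s x).toReal := by
  set n : ℕ := finrank ℝ E with hn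
  set δ : ℝ := π * (2 * Real.sqrt n * (d / s) + (d / s) ^ 2) with hδ
  rcases le_or_gt 1 δ with hδ1 | hδ1
  · exact le_trans (mul_nonpos_of_nonpos_of_nonneg (by linarith) ENNReal.toReal_nonneg) ENNReal.toReal_nonneg
  have hδ' : δ = π * (2 * d * (s * Real.sqrt n) + d ^ 2) / s ^ 2 := by
    rw [hδ]; field_simp
  -- Claim 2.1 on the tile
  have hclaim : ∀ y ∈ (x : E) +ᵥ D, (1 - δ) * gaussianFunction s (x : E) ≤ gaussianFunction s y := by
    intro y hy
    obtain ⟨u, hu, rfl⟩ := Set.mem_vadd_set.1 hy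
    have hyx : ‖((x : E) +ᵥ u) - (x : E)‖ ≤ d := by
      rw [vadd_eq_add, add_sub_cancel_left]; exact hd u hu
    rw [hδ']
    exact gaussianFunction_ge_of_norm_le hd0 hx hyx
  -- volume of the tile
  have hbdd : Bornology.IsBounded D := (isBounded_closedBall (x := (0 : E)) (r := d)).subset fun u hu =>
    mem_closedBall_zero_iff.2 (hd u hu)
  have hvolD : volume D = ENNReal.ofReal (ZLattice.covolume L) := by
    have hcov : ZLattice.covolume L = volume.real D :=
      ZLattice.covolume_eq_measure_fundamentalDomain L volume hD
    rw [hcov, Measure.real, ENNReal.ofReal_toReal hbdd.measure_lt_top.ne]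
  have hvolA : volume ((x : E) +ᵥ D) = ENNReal.ofReal (ZLattice.covolume L) := by
    rw [measure_vadd, hvolD]
  have hA : MeasurableSet ((x : E) +ᵥ D) := hDm.const_vadd (x : E)
  -- the lower bound on the Gaussian measure of the tile
  have hsn : 0 < s ^ n := pow_pos hs _
  have hlow : ENNReal.ofReal ((1 - δ) * gaussianFunction s (x : E) / s ^ n * ZLattice.covolume L) ≤
      continuousGaussian E s ((x : E) +ᵥ D) := by
    calc ENNReal.ofReal ((1 - δ) * gaussianFunction s (x : E) / s ^ n * ZLattice.covolume L)
          = ENNReal.ofReal ((1 - δ) * gaussianFunction s (x : E) / s ^ n) * volume ((x : E) +ᵥ D) := by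
            rw [hvolA, ← ENNReal.ofReal_mul]
            exact div_nonneg (mul_nonneg (by linarith) (gaussianFunction_pos _ _).le) hsn.le
      _ = ∫⁻ _ in (x : E) +ᵥ D, ENNReal.ofReal ((1 - δ) * gaussianFunction s (x : E) / s ^ n) := by
            rw [setLIntegral_const]
      _ ≤ ∫⁻ y in (x : E) +ᵥ D, ENNReal.ofReal (gaussianFunction s y / s ^ n) := by
            refine setLIntegral_mono' hA fun y hy => ENNReal.ofReal_le_ofReal ?_
            exact div_le_div_of_nonneg_right (hclaim y hy) hsn.le
      _ ≤ continuousGaussian E s ((x : E) +ᵥ D) := withDensity_apply_le _ _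
  -- compare with the discrete Gaussian through the Poisson step
  have hq : (discreteGaussian L s 0 x).toReal ≤ ZLattice.covolume L * gaussianFunction s (x : E) / s ^ n :=
    toReal_discreteGaussian_le L hs x
  have hfin : roundedGaussian L D s x ≠ ∞ := PMF.apply_ne_top _ _
  rw [roundedGaussian_apply L hD hs] at hfin ⊢
  have hstep : (1 - δ) * (discreteGaussian L s 0 x).toReal ≤
      (1 - δ) * gaussianFunction s (x : E) / s ^ n * ZLattice.covolume L := by
    have h1 := mul_le_mul_of_nonneg_left hq (show (0 : ℝ) ≤ 1 - δ by linarith)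
    have h2 : (1 - δ) * (ZLattice.covolume L * gaussianFunction s (x : E) / s ^ n) =
        (1 - δ) * gaussianFunction s (x : E) / s ^ n * ZLattice.covolume L := by ring
    linarith
  exact (ENNReal.ofReal_le_iff_le_toReal hfin).1 (le_trans (ENNReal.ofReal_le_ofReal hstep) hlow)

/-- **Regev 2009, Lemma 3.2 (bootstrapping), distributional form.** For a full lattice `L` of an
`n`-dimensional space, a measurable fundamental domain `D ⊆ B̄(0, d)` of `L` and a width `0 < s`, the
law of `y - (y mod D)` for `y ∼ ν_s` is within statistical distance
`π·(2√n·(d/s) + (d/s)²) + 2⁻ⁿ` of the discrete Gaussian `D_{L,s}`. (Regev: `D = P(B)` for an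
LLL-reduced basis `B`, `d ≤ n 2ⁿ λₙ(L)`, `s = r > 2^{2n} λₙ(L)`, distance `2^{-Ω(n)}`.) Proof as printed:
inside the ball `‖x‖ < s√n` the tile bound `one_sub_mul_discreteGaussian_le_roundedGaussian`
(Claim 2.1 + Poisson), outside it Banaszczyk's tail `D_{L,s}(‖x‖ ≥ s√n) ≤ 2⁻ⁿ` (Lemma 2.5), combined by
`PMF.tvDist_le_of_forall_mem_le`. [cite: Regev2009, Lemma 3.2] -/
theorem tvDist_roundedGaussian_discreteGaussian_le {D : Set E} (hD : IsAddFundamentalDomain L D volume)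
    (hDm : MeasurableSet D) {d : ℝ} (hd0 : 0 ≤ d) (hd : ∀ u ∈ D, ‖u‖ ≤ d) {s : ℝ} (hs : 0 < s) :
    (roundedGaussian L D s).tvDist (discreteGaussian L s 0) ≤
      π * (2 * Real.sqrt (finrank ℝ E) * (d / s) + (d / s) ^ 2) + 2⁻¹ ^ finrank ℝ E := by
  set n : ℕ := finrank ℝ E with hn
  set δ : ℝ := π * (2 * Real.sqrt n * (d / s) + (d / s) ^ 2) with hδ
  have hδ0 : 0 ≤ δ := by
    have : 0 ≤ d / s := div_nonneg hd0 hs.le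
    rw [hδ]; positivity
  set S : Set L := {x : L | ‖(x : E)‖ < s * Real.sqrt n} with hS
  have hdomS : ∀ x ∈ S, (1 - δ) * (discreteGaussian L s 0 x).toReal ≤ (roundedGaussian L D s x).toReal :=
    fun x hx => one_sub_mul_discreteGaussian_le_roundedGaussian L hD hDm hd0 hd hs x (le_of_lt hx)
  have htv := PMF.tvDist_le_of_forall_mem_le (roundedGaussian L D s) (discreteGaussian L s 0) S hδ0 hdomS
  refine htv.trans (add_le_add le_rfl ?_)
  -- the tail of the discrete Gaussian outside the ball (Banaszczyk)
  have hcompl : Sᶜ = {x : L | s * Real.sqrt (finrank ℝ E) ≤ ‖(x : E)‖} := by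
    ext x
    simp only [hS, Set.mem_compl_iff, Set.mem_setOf_eq, not_lt]
    rfl
  rw [hcompl]
  have htail := Peikert2009.toOuterMeasure_discreteGaussian_norm_ge_le L hs
  have hne : ((2⁻¹ : ℝ≥0∞) ^ finrank ℝ E) ≠ ∞ := ENNReal.pow_ne_top (by simp)
  calc ((discreteGaussian L s 0).toOuterMeasure {x : L | s * Real.sqrt (finrank ℝ E) ≤ ‖(x : E)‖}).toReal
        ≤ ((2⁻¹ : ℝ≥0∞) ^ finrank ℝ E).toReal := ENNReal.toReal_mono hne htail
    _ = 2⁻¹ ^ finrank ℝ E := by rw [ENNReal.toReal_pow, ENNReal.toReal_inv, ENNReal.toReal_ofNat]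

end Lattice

/-! ### The parallelepiped of a basis, and Regev's numbers -/

section Parallelepiped

variable {E : Type*} [NormedAddCommGroup E] [InnerProductSpace ℝ E] [FiniteDimensional ℝ E]
  [MeasurableSpace E] [BorelSpace E]
variable {ι : Type*} [Fintype ι] (b : Basis ι ℝ E)

/-- **Lemma 3.2 for the parallelepiped of a basis** (Regev's own sampler `y ↦ y - (y mod P(B))`):
with `D = P(b)` (Mathlib's `ZSpan.fundamentalDomain b`, of diameter `≤ ∑ᵢ ‖bᵢ‖`, `ZSpan.norm_fract_le`)
the rounded Gaussian is within `π(2√n·(d/s) + (d/s)²) + 2⁻ⁿ` of `D_{L(b),s}`, `d = ∑ᵢ ‖bᵢ‖`.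
[cite: Regev2009, Lemma 3.2 (proof: "‖y mod P(L)‖ ≤ diam(P(L)) ≤ n 2ⁿ λₙ(L)")] -/
theorem tvDist_roundedGaussian_fundamentalDomain_le {s : ℝ} (hs : 0 < s) :
    (roundedGaussian (Submodule.span ℤ (Set.range b)) (ZSpan.fundamentalDomain b) s).tvDist
        (discreteGaussian (Submodule.span ℤ (Set.range b)) s 0) ≤
      π * (2 * Real.sqrt (finrank ℝ E) * ((∑ i, ‖b i‖) / s) + ((∑ i, ‖b i‖) / s) ^ 2) +
        2⁻¹ ^ finrank ℝ E := by
  refine tvDist_roundedGaussian_discreteGaussian_le (Submodule.span ℤ (Set.range b))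
    (ZSpan.isAddFundamentalDomain b volume) (ZSpan.fundamentalDomain_measurableSet b)
    (Finset.sum_nonneg fun i _ => norm_nonneg _) (fun u hu => ?_) hs
  have hfr : ZSpan.fract b u = u := (ZSpan.fract_eq_self (b := b)).2 hu
  rw [← hfr]
  exact ZSpan.norm_fract_le b u

/-- **Regev's numbers.** If every vector of the basis has norm `≤ M` and the width satisfies
`n·2ⁿ·M ≤ s` (`n = dim E ≥ 1`), then `Δ(round_{P(b)}(ν_s), D_{L(b),s}) ≤ (2π√n + π + 1)·2⁻ⁿ`. With an
LLL-reduced basis (`‖bᵢ‖ ≤ 2^{(n-1)/2} λₙ(L)`, the tree's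
`norm_sq_le_two_pow_mul_successiveMinimum_sq_holds`) the printed hypothesis `s > 2^{2n} λₙ(L)` implies
`n 2ⁿ M ≤ s` for `M = 2^{(n-1)/2} λₙ(L)` as soon as `n ≤ 2^{(n+1)/2}`, i.e. always.
[cite: Regev2009, Lemma 3.2 (statement: "within statistical distance 2^{-Ω(n)} of D_{L,r}")] -/
theorem tvDist_roundedGaussian_le_of_forall_norm_le {M s : ℝ} (hb : ∀ i, ‖b i‖ ≤ M)
    (hn : Fintype.card ι = finrank ℝ E) (hn1 : 1 ≤ finrank ℝ E)
    (hs : (finrank ℝ E : ℝ) * 2 ^ finrank ℝ E * M ≤ s) (hs0 : 0 < s) :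
    (roundedGaussian (Submodule.span ℤ (Set.range b)) (ZSpan.fundamentalDomain b) s).tvDist
        (discreteGaussian (Submodule.span ℤ (Set.range b)) s 0) ≤
      (2 * π * Real.sqrt (finrank ℝ E) + π + 1) * 2⁻¹ ^ finrank ℝ E := by
  set n : ℕ := finrank ℝ E with hndef
  have h := tvDist_roundedGaussian_fundamentalDomain_le b hs0
  refine h.trans ?_
  -- `d/s ≤ 2⁻ⁿ`
  have hd : (∑ i, ‖b i‖) ≤ (n : ℝ) * M := by
    calc (∑ i, ‖b i‖) ≤ ∑ _i : ι, M := Finset.sum_le_sum fun i _ => hb i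
      _ = (Fintype.card ι : ℝ) * M := by rw [Finset.sum_const, nsmul_eq_mul, Finset.card_univ]
      _ = (n : ℝ) * M := by rw [hn]
  have h2n : (0 : ℝ) < 2 ^ n := pow_pos two_pos _
  have hτ : (∑ i, ‖b i‖) / s ≤ 2⁻¹ ^ n := by
    rw [div_le_iff₀ hs0]
    have h3 : (2⁻¹ : ℝ) ^ n * ((n : ℝ) * 2 ^ n * M) = (n : ℝ) * M := by
      rw [inv_pow]; field_simp
    calc (∑ i, ‖b i‖) ≤ (n : ℝ) * M := hd
      _ = (2⁻¹ : ℝ) ^ n * ((n : ℝ) * 2 ^ n * M) := h3.symm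
      _ ≤ 2⁻¹ ^ n * s := mul_le_mul_of_nonneg_left hs (by positivity)
  have hτ0 : 0 ≤ (∑ i, ‖b i‖) / s := div_nonneg (Finset.sum_nonneg fun i _ => norm_nonneg _) hs0.le
  have hτ1 : (2⁻¹ : ℝ) ^ n ≤ 1 := pow_le_one₀ (by norm_num) (by norm_num)
  have hsq : ((∑ i, ‖b i‖) / s) ^ 2 ≤ 2⁻¹ ^ n := by
    calc ((∑ i, ‖b i‖) / s) ^ 2 ≤ (2⁻¹ ^ n) ^ 2 := pow_le_pow_left₀ hτ0 hτ 2
      _ ≤ 2⁻¹ ^ n * 1 := by rw [sq]; exact mul_le_mul_of_nonneg_left hτ1 (by positivity)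
      _ = 2⁻¹ ^ n := mul_one _
  have hπ : 0 < π := Real.pi_pos
  have hsqrt : 0 ≤ Real.sqrt n := Real.sqrt_nonneg _
  calc π * (2 * Real.sqrt n * ((∑ i, ‖b i‖) / s) + ((∑ i, ‖b i‖) / s) ^ 2) + 2⁻¹ ^ n
        ≤ π * (2 * Real.sqrt n * 2⁻¹ ^ n + 2⁻¹ ^ n) + 2⁻¹ ^ n := by gcongr
    _ = (2 * π * Real.sqrt n + π + 1) * 2⁻¹ ^ n := by ring

end Parallelepiped

end Regev2009

end Literature.Computability.Cryptography

end
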